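import Summits.CriticalPhenomena.CardyFormulaZ2.Theorems.IKLinearTransport.Negative.CruxConsequences

/-!
# `IKLinearTransport` (route `CardyIKTransport`, stmt-CriticalPhenomena-5076): the covariance the
# crux forces on the IK limit points

Negative-side support for the crux `CardyIKTransport.IKLinearTransport` (cdisprove unit, refuter
`refuter-cdisprove-stmt-CriticalPhenomena-5076-0`; part 3, after `CruxConsequences.lean` and
`LoadBearing.lean`). If a family `P` is conjugate to critical site-`𝕋` percolation through the
real-linear map `K` (`ConjugateToTri P K`, the crux's template), then the limit points of `P` are
invariant under the one-parameter group `E_c = K⁻¹ ∘ (c ·) ∘ K`, `c ∈ ℂˣ`, of real-linear maps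
conjugate to the conformal similarities (`conjugateToTri_covariance`): `P (E_c R)` and `P R` have the
same limits as `δ → 0⁺`, for every conformal rectangle `R`. Ingredients: Smirnov's theorem and the
invariance of the conformal modulus under `z ↦ c z` (`crossRatio_eq_of_image_data`), both in the tree.
For the crux (`crux_forces_covariance`): a DISPROOF may exhibit, for every `K`, two rectangles `R`,
`E_c R` with different `P_IK`-limit points; a PROOF must in particular make the IK limit points
invariant under a group conjugate to `ℂˣ` — with the exact quarter-turn symmetry of `P_IK` this is what
pins `K` to a similarity (route items IKQuarterTurn / AnchorByRigidity, not touched here).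
-/

noncomputable section

namespace Summit.CriticalPhenomena.CardyFormulaZ2.Theorems.IKLinearTransport.Negative

open Filter Topology Set
open Literature.Probability.Percolation Literature.Probability.RandomPlanarGeometry

/-- Crossing limits of site-`𝕋` are unchanged under a complex dilation-rotation of the rectangle
(Smirnov + conformal invariance of the modulus, both in the tree). [folklore] -/
theorem tendsto_tri_map_mulLeft_iff (S : ConformalRectangle) {c : ℂ} (hc : c ≠ 0) (L : ℝ) :
    Tendsto (triDomainCrossingProb (S.map (Homeomorph.mulLeft₀ c hc))) (𝓝[>] 0) (𝓝 L) ↔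
      Tendsto (triDomainCrossingProb S) (𝓝[>] 0) (𝓝 L) := by
  obtain ⟨φ, x, hφ⟩ := MarkedDomain.exists_isUniformizing_holds S
  obtain ⟨ψ, y, hψ⟩ := MarkedDomain.exists_isUniformizing_holds (S.map (Homeomorph.mulLeft₀ c hc))
  have hη : crossRatio x = crossRatio y :=
    ConformalRectangle.crossRatio_eq_of_image_data (R := S) (S := S.map (Homeomorph.mulLeft₀ c hc))
      (h := fun z => c * z) ((differentiable_id.const_mul c).differentiableOn)
      (mul_right_injective₀ hc).injOn (continuous_const.mul continuous_id).continuousOn rfl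
      (fun _ => rfl) hφ hψ
  have h1 := hasCrossingLimit_triDomainCrossingProb_holds _ φ x hφ
  have h2 := hasCrossingLimit_triDomainCrossingProb_holds _ ψ y hψ
  rw [← hη] at h2
  constructor
  · intro h; rw [tendsto_nhds_unique h h2]; exact h1
  · intro h; rw [tendsto_nhds_unique h h1]; exact h2

/-- COVARIANCE FORCED BY THE CRUX. If `P` is conjugate to site-`𝕋` through `K`, then the limit
points of `P` are invariant under the one-parameter group `E_c = K⁻¹ ∘ (c ·) ∘ K`, `c ∈ ℂˣ`, of
real-linear maps conjugate to the conformal similarities: `P (E_c R)` and `P R` have the same limits.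
(For a quarter-turn-symmetric `P` this is what pins `K` to a similarity — route item
AnchorByRigidity; for a disproof it is a second kill shape: two rectangles `R`, `E_c R` with
different `P`-limits.) [folklore] -/
theorem conjugateToTri_covariance {P : ConformalRectangle → ℝ → ℝ} {K : ℂ ≃L[ℝ] ℂ}
    (h : ConjugateToTri P K) {c : ℂ} (hc : c ≠ 0) (R : ConformalRectangle) (L : ℝ) :
    Tendsto (P (R.map ((K.toHomeomorph.trans (Homeomorph.mulLeft₀ c hc)).trans
      K.symm.toHomeomorph))) (𝓝[>] 0) (𝓝 L) ↔ Tendsto (P R) (𝓝[>] 0) (𝓝 L) := by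
  have hE : ((K.toHomeomorph.trans (Homeomorph.mulLeft₀ c hc)).trans K.symm.toHomeomorph).trans
      K.toHomeomorph = K.toHomeomorph.trans (Homeomorph.mulLeft₀ c hc) := by
    ext z
    simp
  rw [h, h R L, markedDomain_map_map, hE, ← markedDomain_map_map]
  exact tendsto_tri_map_mulLeft_iff _ hc L

/-- COVARIANCE FORCED BY THE CRUX: some real-linear `K` makes the limit points of the crude IK
crossing probabilities invariant under every `E_c = K⁻¹ ∘ (c ·) ∘ K`, `c ≠ 0`. [folklore] -/
theorem crux_forces_covariance :
    Summit.CriticalPhenomena.CardyFormulaZ2.Theses.CardyIKTransport.IKLinearTransport →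
      ∃ K : ℂ ≃L[ℝ] ℂ, ∀ (c : ℂ) (hc : c ≠ 0) (R : ConformalRectangle) (L : ℝ),
        Tendsto (Pik (R.map ((K.toHomeomorph.trans (Homeomorph.mulLeft₀ c hc)).trans
          K.symm.toHomeomorph))) (𝓝[>] 0) (𝓝 L) ↔ Tendsto (Pik R) (𝓝[>] 0) (𝓝 L) := by
  rw [crux_iff_conjugateToTri]
  rintro ⟨K, hK⟩
  exact ⟨K, fun c hc R L => conjugateToTri_covariance hK hc R L⟩

end Summit.CriticalPhenomena.CardyFormulaZ2.Theorems.IKLinearTransport.Negative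

end
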